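import Mathlib
import HarnessLib
import Summits.ValiantsHypothesis.ValiantsHypothesis.Theses.MonotoneRestoration
import Literature.Computability.AlgebraicComplexity.ArithCircuit
import Literature.Computability.AlgebraicComplexity.ArithCircuitProofs
import Literature.Computability.AlgebraicComplexity.MonotoneStructure
import Literature.Computability.AlgebraicComplexity.PermanentIrreducible
import Literature.ModelTheory.FiniteModelTheory.CkEquiv
import Summits.ValiantsHypothesis.ValiantsHypothesis.Theorems.MonotoneRestorationMonotoneRestorationQPCosetCount
import Summits.ValiantsHypothesis.ValiantsHypothesis.Theorems.MonotoneRestorationMonotoneRestorationQPSymmetricLB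
import Summits.ValiantsHypothesis.ValiantsHypothesis.Theorems.MonotoneRestorationMonotoneRestorationQPSupportSymmetrisation
import Summits.ValiantsHypothesis.ValiantsHypothesis.Theorems.MonotoneRestorationMonotoneRestorationQPSparseRegime
import Summits.ValiantsHypothesis.ValiantsHypothesis.Theorems.MonotoneRestorationMonotoneRestorationQPBeta
import Literature.Computability.AlgebraicComplexity.SymmetricArithCircuit
import Literature.Computability.AlgebraicComplexity.DawarWilsenach2025Proofs
import Literature.GroupTheory.PermutationGroups.SmallIndexSubgroups
import Summits.ValiantsHypothesis.ValiantsHypothesis.Theorems.MonotoneRestorationQP.Negative.LoadBearing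
import Summits.ValiantsHypothesis.ValiantsHypothesis.Theorems.MonotoneRestorationMonotoneRestorationQPPermSupportCount
import Literature.Computability.AlgebraicComplexity.ElementarySymmetricCircuit

/-! TTRL-lite variant V20279 of stmt-ValiantsHypothesis-15886 -/

namespace Summit.ValiantsHypothesis.ValiantsHypothesis.Theorems

open Summit.ValiantsHypothesis.ValiantsHypothesis.Theses.MonotoneRestoration
open Literature.Computability.AlgebraicComplexity

/-- TTRL-lite variant V20279 of `stub_esymmRowSums_complexity` (stmt-ValiantsHypothesis-15886):
the transfer step of the dynamic programme for the elementary symmetric functions summed against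
arbitrary weights `Z_j` — with `Z_{-1} := 0`,
`Σ_{j ≤ k} (Z_j + y·Z_{j-1}) · e_{k-j}(T) = Σ_{j ≤ k} Z_j · e_{k-j}(y ∷ T)` over any commutative
semiring (the recurrence `e_r(y ∷ T) = e_r(T) + y · e_{r-1}(T)` read as a substitution on the
state variables). This is `Literature.Computability.AlgebraicComplexity.esymm_transfer_step`
specialised to universe `0` (the instance binder is anonymous here; the variant text names it
`inst`, which only changes a binder name). -/
theorem stub_esymmRowSums_complexity_var20279 :
    ∀ (A : Type) [CommSemiring A] (k : ℕ) (z : ℕ → A) (y : A) (T : Multiset A),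
      ∑ j ∈ Finset.range (k + 1), (z j + y * (if j = 0 then 0 else z (j - 1))) * T.esymm (k - j) =
        ∑ j ∈ Finset.range (k + 1), z j * (y ::ₘ T).esymm (k - j) :=
  fun _A _ k z y T => esymm_transfer_step k z y T

end Summit.ValiantsHypothesis.ValiantsHypothesis.Theorems
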